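import Literature.Analysis.FluidPDE.NormalisedPressureDischarge
import Literature.Analysis.FluidPDE.NormalisedPressureL2Bound
import Literature.Analysis.FluidPDE.NormalisedPressurePV
import HarnessLib

/-!
# Tao (2011/2013), §8, proof of Lemma 8.1: the localised energy inequality (65) — DISCHARGED
# (family `ns`, topic `Literature/Analysis/FluidPDE`)

Sibling of `TaoEnergyLocalisation.lean` (layer 1 of the decomposition of Tao's Lemma 8.1 along its
printed proof), whose named fact `tao2011_localisedEnergyInequality` is Tao's differential
inequality (65) ("pater", arXiv:1108.1165, §8, proof of Lemma 8.1 = "Lemma 44" of the arXiv text,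
pp. 24–25: `∂ₜ E_{η⁴} + X₁ ≲ A²/r² + A⁶/r⁴` for the homogeneous problem) integrated in time, in
the `ν`-honest form
`E_{θ⁸}(u(t)) + (ν/2)∫₀ᵗ X₁ ≤ E_{θ⁸}(u(0)) + C (νA²/r² + A⁶/(ν³r⁴)) t`, `0 < r < R/2`, `t ∈ [0, T]`.
This file lands its discharge `tao2011_localisedEnergyInequality_holds`.

## Why a separate module

The natural host `TaoEnergyLocalisationProofs.lean` (layer 2) proves the fact from the two
pressure inputs of the printed proof
(`tao2011_localisedEnergyInequality_of_pressure :
  tao_pressure_normalisation → tao2011_pressureTerm_estimate → tao2011_localisedEnergyInequality`),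
and the discharges of those inputs live *above* it in the import graph
(`NormalisedPressurePV`, `NormalisedPressureL2Bound` import `TaoEnergyLocalisationPressure`, which
imports `TaoEnergyLocalisationProofs`), so the composition can only be written in a module importing
all of them; this leaf module is that place (it imports exactly the three discharge modules).

## The proof (all inputs are theorems of the tree)

* (54), Tao's Lemma 4.1 (i) — `tao_pressure_normalisation_holds` (`NormalisedPressureDischarge`);
* the estimate of the pressure term `X₅` of (61), (64)–(65) —
  `tao2011_pressureTerm_estimate_of_riesz` (`TaoEnergyLocalisationPressure`, layer 3, with the
  printed commutator step repaired as documented there) from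
  - the existence of the principal values of the Riesz-type singular integral defining
    `p̃ = -Δ⁻¹∂ᵢ∂ⱼ(uᵢuⱼ)` — `hasPressurePV_of_contDiff_holds` (`NormalisedPressurePV`), and
  - its `L²` bound (Stein 1970, Ch. II §4.2 Thm 3) —
    `stein1970_normalisedPressure_eLpNorm_le_holds` (`NormalisedPressureL2Bound`);
* everything else of (58)–(65) (cutoff derivative bounds, Hölder, Gagliardo–Nirenberg–Sobolev,
  Young, the localised energy balance (61) integrated in time) — layer 2,
  `tao2011_localisedEnergyInequality_of_pressure`.

Downstream, `tao_finite_energy_smooth_energy_bound_of_localisedEnergyInequality`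
(`TaoEnergyLocalisation`) turns the fact into Lemma 8.1 itself, whose discharge
`tao_finite_energy_smooth_energy_bound_holds` (`NSFiniteEnergySmoothProofs`) was obtained along the
same chain; the present theorem records that the intermediate layer-1 fact is unconditional too.

## References

* T. Tao, *Localisation and compactness properties of the Navier–Stokes global regularity
  problem*, Anal. PDE 6 (2013) 25–107 = arXiv:1108.1165 (`Tao2011`): §8, Lemma 8.1 ("Lemma 44" of
  the arXiv text, pp. 24–25) and its proof, (54)–(65), in particular (65); Lemma 4.1 (i).
* E. M. Stein, *Singular integrals and differentiability properties of functions* (1970)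
  (`Stein1971`): Ch. II §4.2 Thm 3, Ch. III §1.
-/

namespace Literature.Analysis.FluidPDE

/-- **Tao 2011, §8, proof of Lemma 8.1, (65) integrated in time — discharged.** The localised
energy inequality `tao2011_localisedEnergyInequality` holds: there is an absolute constant `C ≥ 0`
such that for every classical solution `(u, p)` of the unforced Navier–Stokes system with
viscosity `ν > 0` on `[0, T] × ℝ³` with `∫|u(t)|² ≤ A²` on `[0, T]`, every `0 < r`, `2r < R` and
every `t ∈ [0, T]`,
`E_{θ⁸}(u(t)) + (ν/2) ∫₀ᵗ ∫ θ⁸|∇u|² ≤ E_{θ⁸}(u(0)) + C (νA²/r² + A⁶/(ν³r⁴)) t`,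
`θ = taoCutoff R r`. Proof: layer 2 (`tao2011_localisedEnergyInequality_of_pressure`) fed with
the discharged pressure normalisation (Lemma 4.1 (i), `tao_pressure_normalisation_holds`) and the
discharged estimate of the pressure term `X₅` (`tao2011_pressureTerm_estimate_of_riesz` with
`hasPressurePV_of_contDiff_holds` and `stein1970_normalisedPressure_eLpNorm_le_holds`).
[cite: Tao2011, §8, proof of Lemma 8.1, (65)] -/
theorem tao2011_localisedEnergyInequality_holds : tao2011_localisedEnergyInequality :=
  tao2011_localisedEnergyInequality_of_pressure tao_pressure_normalisation_holds
    (tao2011_pressureTerm_estimate_of_riesz hasPressurePV_of_contDiff_holds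
      stein1970_normalisedPressure_eLpNorm_le_holds)

end Literature.Analysis.FluidPDE
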